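import Literature.MathematicalPhysics.QuantumManyBody.PeriodicBoseGasLocalization
import HarnessLib

/-!
# Fournais 2020, §2: the localised Hamiltonian on a small box, and Theorem 2.1

Topic `Literature/MathematicalPhysics/QuantumManyBody`, sibling of `PeriodicBoseGasLocalization.lean`
(provefact `Literature.MathematicalPhysics.QuantumManyBody.BoseGas.Fournais2020_condensation`). The named fact `Fournais2020_eq317` of
that file — the display [Fournais2020, (3.17)], the lower bound on the sliding-box operators
`∑ᵢ T_u^{(i)} + W_{u,N}` of the torus — is, in the paper, the small-box theorem
[Fournais2020, Thm. 2.1] ("actually the same as [BrietzkeFournaisSolovej2020, Thm. 6.1]")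
transported by the unitary equivalences (3.16). This file vendors Thm. 2.1 itself, in first
quantisation, together with the objects (2.3)–(2.9) it speaks about; the deduction of (3.17)
from it (decomposing an `N`-body function on the torus according to which particles lie in
`Λ(u)`, the first-quantised shadow of `𝓕(L²(Ω)) ≅ 𝓕(L²(Λ(u))) ⊗ 𝓕(L²(Ω ∖ Λ(u)))`) is left
to a proofs file.

## Rendering

* The box is `Λ = Λ(u) = u + [-ℓ/2, ℓ/2]³` (`slidingBox ℓ u`; the paper's `Λ` is `Λ(0)`, and
  `Λ(u)` its translate (3.4) — Thm. 2.1 is translation covariant, and (3.17) uses it at every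
  `u`), `ℓ = (K√(ρ_μ a))⁻¹` (2.1) (`boxLength`), `χ_Λ(x) = χ((x-u)/ℓ)` (2.3) (`locFun χ ℓ u`).
* `w(x,y) = χ_Λ(x) W(x-y) χ_Λ(y)`, `w₁(x,y) = χ_Λ(x) W₁(x-y) χ_Λ(y)` (2.8) with `W = v/(χ*χ)(·/ℓ)`,
  `W₁ = g/(χ*χ)(·/ℓ)`, `g = v(1-ω)` (2.4), (2.8) (`bigW`, `bigW₁` of the localisation file):
  `pairLoc`, `pairLoc₁` (`ℝ≥0∞`-valued).
* `(H_Λ(ρ_μ))_M = ∑ᵢ (T^{(i)} - ρ_μ ∫ w₁(xᵢ,y) dy) + ∑_{i<j} w(xᵢ,xⱼ)` (2.6) on `M`-body functions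
  `Φ` on `Λ^M` (`boxConfig`), `T = Q(χ_Λ[-Δ - s⁻²ℓ⁻²]₊χ_Λ + bℓ⁻²)Q` (2.7) = `T_u` (3.13) (`kinLoc`):
  as three `ℝ≥0∞`-valued quadratic forms, the kinetic part `kinBoxN` (as `kinLocN`: `T` on the
  `i`-th particle, the others integrated over `Λ`, written `ℓ⁻³∫_{Λ^M}` of the `i`-th slice — the
  integrand does not depend on `xᵢ ∈ Λ`), the attraction `attrBoxN X = ρ_μ ∑ᵢ ∫ w₁(xᵢ,y) dy` and
  the repulsion `repBoxN X = ∑_{i<j} w(xᵢ,xⱼ)`, the latter two integrated against `|Φ|²` over `Λ^M`.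
* **Thm. 2.1** is the operator inequality (2.11) on the bosonic Fock space `𝓕_s(L²(Λ))`; as
  `H_Λ(ρ_μ)` preserves the particle number it is the family, over `M`, of the form inequalities
  `⟨Φ, (H_Λ(ρ_μ))_M Φ⟩ ≥ (-4πρ_μ²aℓ³ - C₀ρ_μ²aℓ³(ρ_μa³)^{1/2}) ‖Φ‖²` on symmetric `Φ ∈ L²(Λ^M)`
  ("it suffices to establish (2.11) for `⟨Ψ,(H_Λ(ρ_μ))_M Ψ⟩`, `Ψ ∈ ⊗_s^M L²(Λ)`, for arbitrary
  `M`", p. 7), written additively; `kinLoc` is the closed form of `T` extended by `+∞`, so no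
  domain condition is needed beyond measurability.
* Constants are quantified as printed (weakest reading, as for `Fournais2020_eq317`): `K₀` after
  `v, ω, χ, b, s` ("`K` sufficiently large, depending only on `χ, b, s` and `R`"), then `C₀` and
  the smallness `c` of `ρ_μa³` after `K`.

## References

* [Fournais2020] S. Fournais, *Length scales for BEC in the dilute Bose gas*, arXiv:2011.00309,
  EMS Ser. Congr. Rep. 18 (2021), doi:10.4171/ecr/18-1/7: (2.1)–(2.11), Thm. 2.1; (3.15)–(3.17).
* [BrietzkeFournaisSolovej2020] B. Brietzke, S. Fournais, J. P. Solovej, *A simple 2nd order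
  lower bound to the energy of dilute Bose gases*, Comm. Math. Phys. 376 (2020) 323–351,
  arXiv:1901.00539: (5.1)–(5.12), (5.22), Thm. 6.1.
-/

noncomputable section

open MeasureTheory
open scoped ENNReal NNReal

namespace Literature.MathematicalPhysics.QuantumManyBody.BoseGas

/-! ### The localised potentials on the box (2.8) -/

/-- The localised pair potential `w(x,y) = χ_Λ(x) W(x-y) χ_Λ(y)` (2.8) of the box `Λ(u)`
(`χ_Λ = χ_u = χ((·-u)/ℓ)`, `W = v/(χ*χ)(·/ℓ)` (2.4)). [cite: Fournais2020, (2.8)] -/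
def pairLoc (v : ℝ → ℝ≥0∞) (χ : Space → ℝ) (ℓ : ℝ) (u x y : Space) : ℝ≥0∞ :=
  ENNReal.ofReal (locFun χ ℓ u x) * bigW v χ ℓ (x - y) * ENNReal.ofReal (locFun χ ℓ u y)

/-- `w₁(x,y) = w(x,y)(1 - ω(x-y)) = χ_Λ(x) W₁(x-y) χ_Λ(y)`, `W₁ = g/(χ*χ)(·/ℓ)`, `g = v(1-ω)` (2.8).
[cite: Fournais2020, (2.8)] -/
def pairLoc₁ (v : ℝ → ℝ≥0∞) (ω : Space → ℝ) (χ : Space → ℝ) (ℓ : ℝ) (u x y : Space) : ℝ≥0∞ :=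
  ENNReal.ofReal (locFun χ ℓ u x) * bigW₁ v ω χ ℓ (x - y) * ENNReal.ofReal (locFun χ ℓ u y)

/-! ### The `M`-particle sector of `H_Λ(ρ_μ)` (2.6) as quadratic forms -/

/-- The `M`-particle configurations `Λ(u)^M` of the box. [cite: Fournais2020, (2.6)] -/
def boxConfig (M : ℕ) (ℓ : ℝ) (u : Space) : Set (Config M) :=
  {X | ∀ i, X i ∈ slidingBox ℓ u}

/-- `∑ᵢ ⟨Φ, T^{(i)} Φ⟩` for an `M`-body function on the box `Λ(u)` (the kinetic part of (2.6)):
`T` (2.7) (`kinLoc`, (3.13)) on the `i`-th particle, the others integrated over `Λ(u)`, written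
as `ℓ⁻³ ∫_{Λ^M} ⟨Φ(X; ·ᵢ), T Φ(X; ·ᵢ)⟩ dX` with `Φ(X; ·ᵢ) = x ↦ Φ(x₁,…,x_{i-1},x,x_{i+1},…)`
(the integrand is independent of `xᵢ ∈ Λ(u)`, `|Λ(u)| = ℓ³`) — as `kinLocN` on the torus.
[cite: Fournais2020, (2.6)–(2.7)] -/
def kinBoxN {M : ℕ} (χ : Space → ℝ) (ℓ s b : ℝ) (u : Space) (Φ : Config M → ℂ) : ℝ≥0∞ :=
  ∑ i : Fin M, (ENNReal.ofReal ℓ ^ 3)⁻¹ *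
    ∫⁻ X in boxConfig M ℓ u, kinLoc χ ℓ s b u fun x => Φ (Function.update X i x)

/-- The attraction `ρ_μ ∑ᵢ ∫ w₁(xᵢ, y) dy` of (2.6) at the configuration `X` (the chemical-potential
term; `∫ dy` over `ℝ³`, where `w₁(xᵢ,·)` is supported in `Λ(u)`). [cite: Fournais2020, (2.6)] -/
def attrBoxN {M : ℕ} (v : ℝ → ℝ≥0∞) (ω : Space → ℝ) (χ : Space → ℝ) (ℓ ρμ : ℝ) (u : Space)
    (X : Config M) : ℝ≥0∞ :=
  ENNReal.ofReal ρμ * ∑ i : Fin M, ∫⁻ y, pairLoc₁ v ω χ ℓ u (X i) y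

/-- The repulsion `∑_{i<j} w(xᵢ, xⱼ)` of (2.6) at the configuration `X`. [cite: Fournais2020, (2.6)] -/
def repBoxN {M : ℕ} (v : ℝ → ℝ≥0∞) (χ : Space → ℝ) (ℓ : ℝ) (u : Space) (X : Config M) : ℝ≥0∞ :=
  ∑ i : Fin M, ∑ j : Fin M with i < j, pairLoc v χ ℓ u (X i) (X j)

/-! ### Named fact: Theorem 2.1 -/

/-- **Fournais 2020, Theorem 2.1** (lower bound on the localised Hamiltonian; "actually the same
as [BrietzkeFournaisSolovej2020, Thm. 6.1]", which is printed for `K = K₀` and with an extra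
`-Cρ_μ³a²R²`). Suppose `v` satisfies Assumption 1.1 (with scattering solution `ω`, `g = v(1-ω)`,
scattering length `a`) and let the localisation function `χ ∈ C_c^∞((-½,½)³)` be given (and the
constants `b, s > 0` of `T` (2.7)). Suppose that `K` in `ℓ = K⁻¹(ρ_μa)^{-1/2}` (2.1) is chosen
sufficiently large (depending only on `χ, b, s` and the radius `R` of `supp v`). Then there exists
`C₀ > 0` such that for sufficiently small `ρ_μa³`:
`H_Λ(ρ_μ) ≥ -4πρ_μ²aℓ³ - C₀ρ_μ²aℓ³(ρ_μa³)^{1/2}` (2.11) on the bosonic Fock space over `L²(Λ)`,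
`(H_Λ(ρ_μ))_M = ∑ᵢ(T^{(i)} - ρ_μ∫w₁(xᵢ,y)dy) + ∑_{i<j}w(xᵢ,xⱼ)` (2.6) on the `M`-particle sector.
As `H_Λ(ρ_μ)` preserves the particle number, this is vendored as the form inequality on every
sector: for all `M` and all symmetric measurable `Φ` on `Λ^M`,
`ρ_μ∑ᵢ∫∫w₁(xᵢ,y)dy|Φ|² ≤ ∑ᵢ⟨Φ,T^{(i)}Φ⟩ + ∫∑_{i<j}w(xᵢ,xⱼ)|Φ|² + 4πρ_μ²aℓ³(1 + C₀(ρ_μa³)^{1/2})‖Φ‖²`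
(additively in `ℝ≥0∞`, constant renamed `C₀ ↦ 4πC₀`), for the box `Λ = Λ(u)` at any position `u`
(translation covariance; (3.17) uses every `u ∈ Ω`). [cite: Fournais2020, Thm. 2.1 (2.11), (2.6)]
[cite: BrietzkeFournaisSolovej2020, Thm. 6.1] -/
def Fournais2020_thm21 : Prop :=
  ∀ (v : ℝ → ℝ≥0∞), IsRepulsiveFiniteRange v → (∫⁻ x : Space, v ‖x‖) ≠ ⊤ →
    0 < scatteringLength v →
  ∀ (ω : Space → ℝ), IsScatteringSolution v ω →
  ∀ (χ : Space → ℝ), IsLocalizationFunction χ →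
  ∀ (b s : ℝ), 0 < b → 0 < s →
  ∃ K₀ : ℝ, 0 < K₀ ∧ ∀ K : ℝ, K₀ ≤ K →
  ∃ C₀ c : ℝ, 0 < C₀ ∧ 0 < c ∧
    ∀ (ρμ : ℝ), 0 < ρμ →
      let a := (scatteringLength v).toReal
      let ℓ := boxLength K ρμ a
      ρμ * a ^ 3 ≤ c →
      ∀ (M : ℕ) (u : Space) (Φ : Config M → ℂ), Measurable Φ →
        (∀ (σ : Equiv.Perm (Fin M)) (X : Config M), Φ (X ∘ σ) = Φ X) →
        (∫⁻ X in boxConfig M ℓ u, attrBoxN v ω χ ℓ ρμ u X * (‖Φ X‖₊ : ℝ≥0∞) ^ 2) ≤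
          kinBoxN χ ℓ s b u Φ +
            (∫⁻ X in boxConfig M ℓ u, repBoxN v χ ℓ u X * (‖Φ X‖₊ : ℝ≥0∞) ^ 2) +
            ENNReal.ofReal
                (4 * Real.pi * ρμ ^ 2 * a * ℓ ^ 3 * (1 + C₀ * (ρμ * a ^ 3) ^ (1 / 2 : ℝ))) *
              ∫⁻ X in boxConfig M ℓ u, (‖Φ X‖₊ : ℝ≥0∞) ^ 2

/-! ### Basic API -/

/-- `w` is symmetric: `w(x,y) = w(y,x)` (`W` is even as `v(|·|)` and `χ*χ` are).
[cite: Fournais2020, (2.8)] -/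
theorem pairLoc_comm {v : ℝ → ℝ≥0∞} {χ : Space → ℝ} (hχ : IsLocalizationFunction χ) (ℓ : ℝ)
    (u x y : Space) : pairLoc v χ ℓ u x y = pairLoc v χ ℓ u y x := by
  unfold pairLoc bigW
  rw [← neg_sub y x, norm_neg, smul_neg, hχ.selfConv_neg, mul_comm (ENNReal.ofReal (locFun χ ℓ u x)),
    mul_right_comm, mul_comm (ENNReal.ofReal (locFun χ ℓ u y))]

/-- Off the box `Λ(u)` (in the first variable) the localised potentials vanish.
[cite: Fournais2020, (2.8)] -/
theorem pairLoc_eq_zero_of_not_mem {v : ℝ → ℝ≥0∞} {χ : Space → ℝ} (hχ : IsLocalizationFunction χ)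
    {ℓ : ℝ} (hℓ : 0 < ℓ) {u x : Space} (hx : x ∉ slidingBox ℓ u) (y : Space) :
    pairLoc v χ ℓ u x y = 0 := by
  simp [pairLoc, locFun_eq_zero_of_not_mem hχ hℓ hx]

/-- Off the box `Λ(u)` the localised potential `w₁` vanishes. [cite: Fournais2020, (2.8)] -/
theorem pairLoc₁_eq_zero_of_not_mem {v : ℝ → ℝ≥0∞} {ω : Space → ℝ} {χ : Space → ℝ}
    (hχ : IsLocalizationFunction χ) {ℓ : ℝ} (hℓ : 0 < ℓ) {u x : Space}
    (hx : x ∉ slidingBox ℓ u) (y : Space) : pairLoc₁ v ω χ ℓ u x y = 0 := by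
  simp [pairLoc₁, locFun_eq_zero_of_not_mem hχ hℓ hx]

/-- With no particles all three forms vanish and Thm. 2.1 reads `0 ≤ const · ‖Φ‖²`; with one
particle there is no repulsion: `repBoxN = 0` for `M ≤ 1`. [cite: Fournais2020, (2.6)] -/
theorem repBoxN_eq_zero_of_subsingleton {M : ℕ} (hM : M ≤ 1) (v : ℝ → ℝ≥0∞) (χ : Space → ℝ)
    (ℓ : ℝ) (u : Space) (X : Config M) : repBoxN v χ ℓ u X = 0 := by
  unfold repBoxN
  refine Finset.sum_eq_zero fun i _ => Finset.sum_eq_zero fun j hj => ?_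
  simp only [Finset.mem_filter] at hj
  have h1 : (i : ℕ) < j := hj.2
  have h2 := j.isLt
  omega

end Literature.MathematicalPhysics.QuantumManyBody.BoseGas
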